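import Literature.RepresentationTheory.Kovacevic2021.SU21IrreducibleModels
import Literature.RepresentationTheory.Kovacevic2021.SU21IrreducibleCohomologyTable
import Literature.RepresentationTheory.Kovacevic2021.SU21Unitarity
import Literature.Algebra.Lie.ChevalleyEilenbergDirectSum
import HarnessLib

/-!
# Borel–Wallach VI Thm 4.11 for `SU(2,1)` HOLDS on the irreducible Kovačević `K`-type data:
# an honest instance of the dictionary `SUn1Table 2` satisfying `VI_4_11`

`Literature.RepresentationTheory.BorelWallach2000.SUn1CohomologicalModules` transcribes [BorelWallach2000,
VI 4.7–4.12] as a PREDICATE `SUn1Table.VI_4_11` on a dictionary `SUn1Table n` (the irreducible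
`(𝔤,K)`-modules of `SU(n,1)` up to equivalence, the families `J_{ij}`, `D_i`, the dimension functions
`dim H^q(𝔤,K;V)`, `dim Hom_K(F_{p,q}, V)`, `dim Hom_K(Λ^{p,q}, V)`), asserting nothing: "a consumer supplies the
dictionary from its own model of `SU(n,1)` and takes `(h : T.VI_4_11)` as an explicit hypothesis".  This file
SUPPLIES such a model for `n = 2` and PROVES the hypothesis for it (`kovacevicTable_VI_4_11`):

* `Mod` = the irreducible Kovačević `K`-type data [Kovacevic2021, §3] modulo isomorphism of their
  `𝔤𝔩(3,ℂ)`-modules (`IrrMod`; the `K`-types of a datum and its `(𝔤,K)`-cohomology are isomorphism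
  invariants, §1);
* `J 0 0 = U(0)`, `J 1 0 = Z(3)`, `J 0 1 = Z(-3)`, `D 0 = U(0,-6)`, `D 1 = W(3,0)`, `D 2 = U(0,6)` (the classes of
  `trivialMod`, `ladderPlus`, `ladderMinus`, `antiholDS`, `midDS`, `holDS`);
* `hdim V q = dim_ℂ H^q(𝔤𝔩₃, 𝔨; V)` (the tree's relative Chevalley–Eilenberg cohomology), `fmult V p q` = the
  multiplicity of the `K`-type `F_{p,q}` (`F_{0,0} = V_{1,0}`, `F_{1,0} = V_{2,3}`, `F_{0,1} = V_{2,-3}`,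
  `F_{2,0} = V_{1,6}`, `F_{1,1} = V_{3,0}`, `F_{0,2} = V_{1,-6}`; multiplicity one), `homKdim V p q` = the number of
  `K`-types of `Λ^{p,q} = Λ^p 𝔭⁺ ⊗ Λ^q 𝔭⁻` occurring in `V` (`Λ^{1,1} = F_{0,0} ⊕ F_{1,1}`, `Λ^{2,1} ≅ F_{1,0}`,
  `Λ^{1,2} ≅ F_{0,1}`, `Λ^{2,2} ≅ F_{0,0}`, otherwise `Λ^{p,q} = F_{p,q}`);
* `unitary V` = some representative carries a positive-definite Hermitian form for which `𝔰𝔲(2,1)` acts by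
  skew-adjoint operators (`SU21Unitarity.IsUnitarizable`; not used by `VI_4_11`; proved here only for
  `J_{0,0} = U(0)`, `kovacevicTable_unitary_J00` — `VI_4_12` for the other five classes is NOT proved here).

Clause (1) of `VI_4_11` is `SU21IrreducibleModels.exists_equiv_model_of_isIrreducible`; (2), (3) are the tables of
`SU21CohomologyAllDegrees`; (9), (4.9 (1)), (4.8 (5)), (4.10 (3)) are `K`-type bookkeeping.

## References

* A. Borel, N. Wallach (2000), VI 4.7–4.12 pp. 130–133. [BorelWallach2000]
* D. Kovačević, Acta Math. Spalatensia 1 (2021) 105–125, §3 Def 1, Thm 2, §4 Thm 4, Thm 5. [Kovacevic2021]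
-/

noncomputable section

open Module
open Literature.Algebra.Lie Literature.Algebra.Lie.ChevalleyEilenberg
open Literature.RepresentationTheory.BorelWallach2000

namespace Literature.RepresentationTheory.Kovacevic2021

-- Mathlib idiom (Mathlib/Algebra/Lie/OfAssociative.lean): commutator brackets on associative algebras; needed for
-- the `𝔤𝔩(3,ℂ)`-module structure on `𝒟.V`, as in every file of this directory.
attribute [local instance 100] LieRing.ofAssociativeRing

namespace SU21Datum

/-! ## §1 The `K`-types are an isomorphism invariant -/

variable {𝒟₁ 𝒟₂ : SU21Datum}

/-- a `𝔤𝔩(3,ℂ)`-isomorphism maps `𝔨`-highest-weight vectors of type `(n,m)` to such vectors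
[cite: Kovacevic2021, §3 Def 1] -/
theorem mem_hwSpace_of_equiv (e : 𝒟₁.V ≃ₗ⁅ℂ, gl3⁆ 𝒟₂.V) {n m : ℤ} {v : 𝒟₁.V} (hv : v ∈ 𝒟₁.hwSpace n m) :
    e v ∈ 𝒟₂.hwSpace n m := by
  rw [mem_hwSpace_iff_lie] at hv ⊢
  have hmap : ∀ (x : gl3) (w : 𝒟₁.V), e ⁅x, w⁆ = ⁅x, e w⁆ := fun x w => (e : 𝒟₁.V →ₗ⁅ℂ, gl3⁆ 𝒟₂.V).map_lie x w
  obtain ⟨h1, h2, h3⟩ := hv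
  refine ⟨?_, ?_, ?_⟩
  · rw [← hmap, h1, map_zero]
  · rw [← hmap, h2, map_smul]
  · rw [← hmap, h3, map_smul]

/-- **The `K`-types of isomorphic data coincide** (the multiplicity of `V_{n,m}` is `dim` of the
`𝔨`-highest-weight space, an isomorphism invariant). [cite: Kovacevic2021, §3 Def 1] -/
theorem S_eq_of_equiv (e : 𝒟₁.V ≃ₗ⁅ℂ, gl3⁆ 𝒟₂.V) : 𝒟₁.S = 𝒟₂.S := by
  -- `e` restricts to an injection `hwSpace₁ n m → hwSpace₂ n m`, and `e.symm` the other way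
  have key : ∀ {𝒟₁ 𝒟₂ : SU21Datum} (e : 𝒟₁.V ≃ₗ⁅ℂ, gl3⁆ 𝒟₂.V) (n m : ℤ),
      (n, m) ∈ 𝒟₁.S → (n, m) ∈ 𝒟₂.S := by
    intro 𝒟₁ 𝒟₂ e n m h
    by_contra h'
    have hv := mem_hwSpace_of_equiv e (𝒟₁.vec_one_mem_hwSpace n m)
    rw [hwSpace_eq_span, vec_of_not_mem 1 h', Submodule.span_zero_singleton, Submodule.mem_bot] at hv
    exact 𝒟₁.vec_ne_zero ⟨h, le_rfl, 𝒟₁.one_le_of_mem h⟩ (e.injective (by rw [hv, map_zero]))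
  ext ⟨n, m⟩
  exact ⟨key e n m, key e.symm n m⟩

/-! ## §2 Irreducible data up to isomorphism -/

/-- an irreducible `K`-type datum: the `𝔤𝔩(3,ℂ)`-module `𝒟.V` is irreducible [cite: Kovacevic2021, §3 Thm 2] -/
abbrev IrrDatum : Type := {𝒟 : SU21Datum // LieModule.IsIrreducible ℂ gl3 𝒟.V}

/-- isomorphism of the `𝔤𝔩(3,ℂ)`-modules of irreducible data, as a setoid [cite: BorelWallach2000, VI 4.7] -/
instance isoSetoid : Setoid IrrDatum where
  r a b := Nonempty (a.1.V ≃ₗ⁅ℂ, gl3⁆ b.1.V)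
  iseqv :=
    ⟨fun _ => ⟨LieModuleEquiv.refl⟩, fun ⟨e⟩ => ⟨e.symm⟩, fun ⟨e⟩ ⟨f⟩ => ⟨e.trans f⟩⟩

/-- **The irreducible `K`-type data up to isomorphism of their modules** (BW's "irreducible `(𝔤,K)`-modules up to
equivalence", for the modules with `K`-multiplicities one of [Kovacevic2021, §3]). [cite: BorelWallach2000, VI 4.7] -/
def IrrMod : Type := Quotient isoSetoid

namespace IrrMod

/-- the class of an irreducible datum [cite: BorelWallach2000, VI 4.7] -/
def mk (𝒟 : SU21Datum) (h : LieModule.IsIrreducible ℂ gl3 𝒟.V) : IrrMod := Quotient.mk isoSetoid ⟨𝒟, h⟩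

/-- the `K`-type set of a class (well defined by `S_eq_of_equiv`) [cite: Kovacevic2021, §3 Def 1] -/
def S : IrrMod → Set (ℤ × ℤ) :=
  Quotient.lift (fun a : IrrDatum => a.1.S) fun _ _ h => by obtain ⟨e⟩ := h; exact S_eq_of_equiv e

/-- `dim H^q(𝔤𝔩₃, 𝔨; V)` of a class (isomorphic modules have isomorphic relative cohomology)
[cite: BorelWallach2000, I §1.2, VI Thm 4.11] -/
def hdim : IrrMod → ℕ → ℕ :=
  Quotient.lift (fun a : IrrDatum => fun q => finrank ℂ (relCohomology ℂ gl3 a.1.V kSub q)) fun _ _ h => by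
    obtain ⟨e⟩ := h
    exact funext fun q => LinearEquiv.finrank_eq (relCohomologyEquivOfLieModuleEquiv kSub e q)

/-- `mk` computes `S` [cite: Kovacevic2021, §3 Def 1] -/
@[simp] theorem S_mk (𝒟 : SU21Datum) (h : LieModule.IsIrreducible ℂ gl3 𝒟.V) : (mk 𝒟 h).S = 𝒟.S := rfl

/-- `mk` computes `hdim` [cite: BorelWallach2000, VI Thm 4.11] -/
@[simp] theorem hdim_mk (𝒟 : SU21Datum) (h : LieModule.IsIrreducible ℂ gl3 𝒟.V) (q : ℕ) :
    (mk 𝒟 h).hdim q = finrank ℂ (relCohomology ℂ gl3 𝒟.V kSub q) := rfl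

end IrrMod

/-! ## §3 `K`-type bookkeeping: `F_{p,q}` and `Λ^{p,q}` -/

open Classical in
/-- indicator of a `K`-type in a `K`-type set [cite: Kovacevic2021, §3 Def 1] -/
def kInd (S : Set (ℤ × ℤ)) (x : ℤ × ℤ) : ℕ := if x ∈ S then 1 else 0

/-- `dim Hom_K(F_{p,q}, V)` from the `K`-type set: `F_{0,0} = V_{1,0}`, `F_{1,0} = V_{2,3}`, `F_{0,1} = V_{2,-3}`,
`F_{2,0} = V_{1,6}`, `F_{1,1} = V_{3,0}`, `F_{0,2} = V_{1,-6}` (`p + q ≤ 2`), each of multiplicity `≤ 1`.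
[cite: BorelWallach2000, VI 4.8 (5), Lemma 4.9] [cite: Kovacevic2021, §3 Def 1] -/
def fmultS (S : Set (ℤ × ℤ)) (p q : ℕ) : ℕ :=
  if p = 0 ∧ q = 0 then kInd S (1, 0) else if p = 1 ∧ q = 0 then kInd S (2, 3)
  else if p = 0 ∧ q = 1 then kInd S (2, -3) else if p = 2 ∧ q = 0 then kInd S (1, 6)
  else if p = 1 ∧ q = 1 then kInd S (3, 0) else if p = 0 ∧ q = 2 then kInd S (1, -6) else 0

/-- `dim Hom_K(Λ^{p,q}, V)`, `Λ^{p,q} = Λ^p 𝔭⁺ ⊗ Λ^q 𝔭⁻` (`𝔭^± = V_{2,±3}`): `Λ^{1,1} = V_{1,0} ⊕ V_{3,0}`,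
`Λ^{2,1} = V_{2,3}`, `Λ^{1,2} = V_{2,-3}`, `Λ^{2,2} = V_{1,0}`, and `Λ^{p,q} = F_{p,q}` in the other cases with
`p, q ≤ 2`. [cite: BorelWallach2000, VI 4.8 (5), Lemma 4.9 (1)] -/
def homKdimS (S : Set (ℤ × ℤ)) (p q : ℕ) : ℕ :=
  if p = 1 ∧ q = 1 then kInd S (1, 0) + kInd S (3, 0) else if p = 2 ∧ q = 1 then kInd S (2, 3)
  else if p = 1 ∧ q = 2 then kInd S (2, -3) else if p = 2 ∧ q = 2 then kInd S (1, 0) else fmultS S p q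

/-! ## §4 The dictionary and Theorem 4.11 -/

/-- the `J_{ij}` of `SU(2,1)` (`i + j ≤ 1`): `J_{0,0} = U(0)`, `J_{1,0} = Z(3)`, `J_{0,1} = Z(-3)`
[cite: BorelWallach2000, VI 4.8, Thm 4.11 (9)] [cite: Kovacevic2021, §4 Thm 5] -/
def jMod : ℕ → ℕ → IrrMod
  | 0, 0 => IrrMod.mk trivialMod trivialMod_isIrreducible
  | 0, _ + 1 => IrrMod.mk ladderMinus ladderMinus_isIrreducible
  | _ + 1, _ => IrrMod.mk ladderPlus ladderPlus_isIrreducible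

/-- the discrete series `D_0 = U(0,-6)`, `D_1 = W(3,0)`, `D_2 = U(0,6)` (labelled by `F_{i,2-i} ⊂ D_i`)
[cite: BorelWallach2000, VI 4.8, 4.10 (3)] [cite: Kovacevic2021, §4 Thm 5] -/
def dMod : Fin 3 → IrrMod :=
  ![IrrMod.mk antiholDS antiholDS_isIrreducible, IrrMod.mk midDS midDS_isIrreducible,
    IrrMod.mk holDS holDS_isIrreducible]

/-- **The Kovačević model of Borel–Wallach's dictionary for `SU(2,1)`.** [cite: BorelWallach2000, VI 4.7–4.10]
[cite: Kovacevic2021, §3, §4] -/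
def kovacevicTable : SUn1Table.{0} 2 where
  Mod := IrrMod
  unitary V := ∃ a : IrrDatum, Quotient.mk isoSetoid a = V ∧ a.1.IsUnitarizable
  J i j _ := jMod i j
  D := dMod
  hdim := IrrMod.hdim
  fmult V := fmultS V.S
  homKdim V := homKdimS V.S

/-! ### The `K`-type bookkeeping of the six classes -/

/-- `fmultS` on the six `K`-type sets, for `p + q ≤ 2`: `F_{p,q}` occurs in `J_{ij}` iff `(p,q) = (i,j)`, in `D_i`
iff `(p,q) = (i, 2-i)`. [cite: BorelWallach2000, VI Thm 4.11 (9), 4.10 (3)] -/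
theorem fmultS_six (p q : ℕ) (hpq : p + q ≤ 2) :
    fmultS trivialMod.S p q = (if p = 0 ∧ q = 0 then 1 else 0) ∧
    fmultS ladderPlus.S p q = (if p = 1 ∧ q = 0 then 1 else 0) ∧
    fmultS ladderMinus.S p q = (if p = 0 ∧ q = 1 then 1 else 0) ∧
    fmultS antiholDS.S p q = (if p = 0 ∧ q = 2 then 1 else 0) ∧
    fmultS midDS.S p q = (if p = 1 ∧ q = 1 then 1 else 0) ∧
    fmultS holDS.S p q = (if p = 2 ∧ q = 0 then 1 else 0) := by
  obtain ⟨a1, a2, a3⟩ := six_Ktypes.1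
  obtain ⟨b1, b2, b3⟩ := six_Ktypes.2.1
  obtain ⟨c1, c2, c3⟩ := six_Ktypes.2.2.1
  obtain ⟨d1, d2, d3⟩ := six_Ktypes.2.2.2.1
  obtain ⟨e1, e2, e3⟩ := six_Ktypes.2.2.2.2.1
  obtain ⟨f1, f2, f3⟩ := six_Ktypes.2.2.2.2.2
  obtain ⟨a4, a5, a6⟩ := six_Ktypes₂.1
  obtain ⟨b4, b5, b6⟩ := six_Ktypes₂.2.1
  obtain ⟨c4, c5, c6⟩ := six_Ktypes₂.2.2.1
  obtain ⟨d4, d5, d6⟩ := six_Ktypes₂.2.2.2.1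
  obtain ⟨e4, e5, e6⟩ := six_Ktypes₂.2.2.2.2.1
  obtain ⟨f4, f5, f6⟩ := six_Ktypes₂.2.2.2.2.2
  have hp : p ≤ 2 := by omega
  have hq : q ≤ 2 := by omega
  interval_cases p <;> interval_cases q <;>
    simp_all [fmultS, kInd]

/-- A cohomological class is the class of one of the six models (clause (1)).
[cite: BorelWallach2000, VI Thm 4.11 (1)] -/
theorem eq_six_of_cohomological (V : IrrMod) (hV : ∃ q, V.hdim q ≠ 0) :
    V = IrrMod.mk trivialMod trivialMod_isIrreducible ∨ V = IrrMod.mk holDS holDS_isIrreducible ∨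
      V = IrrMod.mk antiholDS antiholDS_isIrreducible ∨ V = IrrMod.mk ladderPlus ladderPlus_isIrreducible ∨
      V = IrrMod.mk ladderMinus ladderMinus_isIrreducible ∨ V = IrrMod.mk midDS midDS_isIrreducible := by
  induction V using Quotient.inductionOn with
  | h a =>
    obtain ⟨𝒟, h𝒟⟩ := a
    obtain ⟨q, hq⟩ := hV
    haveI := h𝒟
    obtain ⟨T, hT, -, ⟨e⟩⟩ := 𝒟.exists_equiv_model_of_isIrreducible (q := q) hq
    have sound : ∀ (T : SU21Datum) (hT : LieModule.IsIrreducible ℂ gl3 T.V), Nonempty (𝒟.V ≃ₗ⁅ℂ, gl3⁆ T.V) →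
        Quotient.mk isoSetoid ⟨𝒟, h𝒟⟩ = IrrMod.mk T hT := fun T hT h => Quotient.sound h
    rcases hT with rfl | rfl | rfl | rfl | rfl | rfl
    · exact Or.inl (sound _ _ ⟨e⟩)
    · exact Or.inr (Or.inl (sound _ _ ⟨e⟩))
    · exact Or.inr (Or.inr (Or.inl (sound _ _ ⟨e⟩)))
    · exact Or.inr (Or.inr (Or.inr (Or.inl (sound _ _ ⟨e⟩))))
    · exact Or.inr (Or.inr (Or.inr (Or.inr (Or.inl (sound _ _ ⟨e⟩)))))
    · exact Or.inr (Or.inr (Or.inr (Or.inr (Or.inr (sound _ _ ⟨e⟩)))))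

/-- **Borel–Wallach VI Theorem 4.11 (with (9), Lemma 4.9 (1), 4.8 (5), 4.10 (3)) HOLDS for `SU(2,1)` on the
Kovačević model**: the transcribed predicate `SUn1Table.VI_4_11` is a theorem for `kovacevicTable`.
[cite: BorelWallach2000, VI Thm 4.11 pp. 132–133] [cite: Kovacevic2021, §3 Thm 2, §4 Thm 5] -/
theorem kovacevicTable_VI_4_11 : kovacevicTable.VI_4_11 := by
  refine ⟨?_, ?_, ?_, ?_, ?_, ?_, ?_, ?_⟩
  · -- (1) cohomological ⇒ `J_{ij}` or `D_i`
    intro V hV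
    rcases eq_six_of_cohomological V hV with h | h | h | h | h | h
    · exact Or.inl ⟨0, 0, by omega, h⟩
    · exact Or.inr ⟨2, h⟩
    · exact Or.inr ⟨0, h⟩
    · exact Or.inl ⟨1, 0, by omega, h⟩
    · exact Or.inl ⟨0, 1, by omega, h⟩
    · exact Or.inr ⟨1, h⟩
  · -- (2) `dim H^q(D_i) = [q = 2]`
    intro i q
    fin_cases i
    · change (q = 2 → (IrrMod.mk antiholDS _).hdim q = 1) ∧ (q ≠ 2 → (IrrMod.mk antiholDS _).hdim q = 0)
      rw [IrrMod.hdim_mk, finrank_relCohomology_antiholDS]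
      exact ⟨fun h => if_pos h, fun h => if_neg h⟩
    · change (q = 2 → (IrrMod.mk midDS _).hdim q = 1) ∧ (q ≠ 2 → (IrrMod.mk midDS _).hdim q = 0)
      rw [IrrMod.hdim_mk, finrank_relCohomology_midDS]
      exact ⟨fun h => if_pos h, fun h => if_neg h⟩
    · change (q = 2 → (IrrMod.mk holDS _).hdim q = 1) ∧ (q ≠ 2 → (IrrMod.mk holDS _).hdim q = 0)
      rw [IrrMod.hdim_mk, finrank_relCohomology_holDS]
      exact ⟨fun h => if_pos h, fun h => if_neg h⟩
  · -- (3) `dim H^q(J_{ij}) = [q = i + j + 2l]`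
    intro i j h q
    rcases (show (i = 0 ∧ j = 0) ∨ (i = 1 ∧ j = 0) ∨ (i = 0 ∧ j = 1) by omega) with
      ⟨rfl, rfl⟩ | ⟨rfl, rfl⟩ | ⟨rfl, rfl⟩
    · change (SUn1Table.JDegree 2 0 0 q → (IrrMod.mk trivialMod _).hdim q = 1) ∧
        (¬ SUn1Table.JDegree 2 0 0 q → (IrrMod.mk trivialMod _).hdim q = 0)
      rw [IrrMod.hdim_mk, finrank_relCohomology_J00_eq_jDegree]
      exact ⟨fun h => if_pos h, fun h => if_neg h⟩
    · change (SUn1Table.JDegree 2 1 0 q → (IrrMod.mk ladderPlus _).hdim q = 1) ∧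
        (¬ SUn1Table.JDegree 2 1 0 q → (IrrMod.mk ladderPlus _).hdim q = 0)
      rw [IrrMod.hdim_mk, finrank_relCohomology_J10_eq_jDegree]
      exact ⟨fun h => if_pos h, fun h => if_neg h⟩
    · change (SUn1Table.JDegree 2 0 1 q → (IrrMod.mk ladderMinus _).hdim q = 1) ∧
        (¬ SUn1Table.JDegree 2 0 1 q → (IrrMod.mk ladderMinus _).hdim q = 0)
      rw [IrrMod.hdim_mk, finrank_relCohomology_J01_eq_jDegree]
      exact ⟨fun h => if_pos h, fun h => if_neg h⟩
  · -- (9) `F_{p,q} ⊂ J_{ij}` iff `(p,q) = (i,j)`, multiplicity one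
    intro i j h p q hpq
    obtain ⟨t1, t2, t3, -, -, -⟩ := fmultS_six p q hpq
    rcases (show (i = 0 ∧ j = 0) ∨ (i = 1 ∧ j = 0) ∨ (i = 0 ∧ j = 1) by omega) with
      ⟨rfl, rfl⟩ | ⟨rfl, rfl⟩ | ⟨rfl, rfl⟩
    · change ((p = 0 ∧ q = 0) → fmultS (IrrMod.mk trivialMod _).S p q = 1) ∧
        (¬ (p = 0 ∧ q = 0) → fmultS (IrrMod.mk trivialMod _).S p q = 0)
      rw [IrrMod.S_mk, t1]
      exact ⟨fun h => if_pos h, fun h => if_neg h⟩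
    · change ((p = 1 ∧ q = 0) → fmultS (IrrMod.mk ladderPlus _).S p q = 1) ∧
        (¬ (p = 1 ∧ q = 0) → fmultS (IrrMod.mk ladderPlus _).S p q = 0)
      rw [IrrMod.S_mk, t2]
      exact ⟨fun h => if_pos h, fun h => if_neg h⟩
    · change ((p = 0 ∧ q = 1) → fmultS (IrrMod.mk ladderMinus _).S p q = 1) ∧
        (¬ (p = 0 ∧ q = 1) → fmultS (IrrMod.mk ladderMinus _).S p q = 0)
      rw [IrrMod.S_mk, t3]
      exact ⟨fun h => if_pos h, fun h => if_neg h⟩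
  · -- (4.9 (1)) `Λ^{1,1} = L Λ^{0,0} ⊕ F_{1,1}` (only `p = q = 0` when `n = 2`)
    intro V p q hpq
    obtain ⟨rfl, rfl⟩ : p = 0 ∧ q = 0 := by omega
    change homKdimS V.S 1 1 = homKdimS V.S 0 0 + fmultS V.S 1 1
    simp [homKdimS, fmultS]
  · -- (4.8 (5)) `Λ^{p,0} = F_{p,0}`, `Λ^{0,p} = F_{0,p}`
    intro V p hp
    change homKdimS V.S p 0 = fmultS V.S p 0 ∧ homKdimS V.S 0 p = fmultS V.S 0 p
    interval_cases p <;> simp [homKdimS]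
  · -- (4.10 (3)) the only `F_{p,q}` (`p + q ≤ 2`) in `D_i` is `F_{i,2-i}`
    intro i p q hpq hne
    obtain ⟨-, -, -, t4, t5, t6⟩ := fmultS_six p q hpq
    fin_cases i
    · change fmultS (IrrMod.mk antiholDS _).S p q ≠ 0 at hne
      rw [IrrMod.S_mk, t4] at hne
      by_contra hc
      exact hne (if_neg (by simpa using hc))
    · change fmultS (IrrMod.mk midDS _).S p q ≠ 0 at hne
      rw [IrrMod.S_mk, t5] at hne
      by_contra hc
      exact hne (if_neg (by simpa using hc))
    · change fmultS (IrrMod.mk holDS _).S p q ≠ 0 at hne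
      rw [IrrMod.S_mk, t6] at hne
      by_contra hc
      exact hne (if_neg (by simpa using hc))
  · -- (4.10 (3)⁺) `F_{i,2-i} ⊂ D_i`
    intro i
    fin_cases i
    · change fmultS (IrrMod.mk antiholDS _).S 0 (2 - 0) ≠ 0
      rw [IrrMod.S_mk, (fmultS_six 0 2 (by omega)).2.2.2.1]
      simp
    · change fmultS (IrrMod.mk midDS _).S 1 (2 - 1) ≠ 0
      rw [IrrMod.S_mk, (fmultS_six 1 1 (by omega)).2.2.2.2.1]
      simp
    · change fmultS (IrrMod.mk holDS _).S 2 (2 - 2) ≠ 0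
      rw [IrrMod.S_mk, (fmultS_six 2 0 (by omega)).2.2.2.2.2]
      simp

/-- `J_{0,0} = U(0)` is unitary in the model (the trivial module carries the standard form).
[cite: BorelWallach2000, VI Thm 4.12 (2)] [cite: Kovacevic2021, §4 Thm 4] -/
theorem kovacevicTable_unitary_J00 : kovacevicTable.unitary (kovacevicTable.J 0 0 (by omega)) :=
  ⟨⟨trivialMod, trivialMod_isIrreducible⟩, rfl, trivialMod_isUnitarizable⟩

/-- **Hence every proved consequence of `VI_4_11` in `SUn1CohomologicalModules` holds for the Kovačević
model unconditionally**, e.g. the degree-one isolation: a class has `H¹ ≠ 0` iff it is `J_{1,0}` or `J_{0,1}`.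
[cite: BorelWallach2000, VI Thm 4.11 (1)–(3)] -/
theorem kovacevicTable_hdim_one_ne_zero_iff (V : IrrMod) :
    kovacevicTable.hdim V 1 ≠ 0 ↔
      V = kovacevicTable.J 1 0 (by omega) ∨ V = kovacevicTable.J 0 1 (by omega) :=
  kovacevicTable.hdim_one_ne_zero_iff kovacevicTable_VI_4_11 V

end SU21Datum

end Literature.RepresentationTheory.Kovacevic2021
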